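import Summits.Parity.GeneralizedHardyLittlewood.Theorems.LiouvilleShiftedTablesSieveToMAvgParams
import Literature.NumberTheory.Sieve.BombieriVinogradovMoebius

/-!
# Sieve glue for `SieveToMAvg`, part 12b: the parameter conditions hold for large heights

Support file for item stmt-Parity-14274 (route `LiouvilleShiftedTables`).  With `0 < δ ≤ 1/12`,
`4δ ≤ ρ`, thresholds `a' = 2δ`, `b' = 1/3 + δ/2`, slicing `Δ = (log Y)^{−A₁}` and level `Q ≤ Y^{δ/4}`,
every dyadic scale `x ∈ [Y/(2(log Y)^{13}), Y/2]` satisfies `ScaleOK j x Y …` for `j = 1, 2, 3` once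
`Y` is large (`scaleOK_eventually`): all conditions are comparisons of fixed powers of `x`, `Y` and
`log Y`.
-/

namespace Summit.Parity.GeneralizedHardyLittlewood.Theorems.SieveToMAvg

open Finset Real Filter
open scoped ArithmeticFunction.zeta ArithmeticFunction.sigma ArithmeticFunction.vonMangoldt
open Literature.NumberTheory.Sieve.BVMoebius (eventually_log_rpow_le_rpow')

section Eventually

variable {δ ρ : ℝ}

/-- The conditions at the dyadic scale `x` alone hold for large `x`. [folklore] -/
theorem x_conditions_eventually (hδ : 0 < δ) (hδ12 : δ ≤ 1 / 12) :
    ∀ᶠ x : ℝ in atTop, 1 ≤ x ∧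
      2 * δ * Real.log (2 * x) ≤ Real.log (x / 64) ∧
      6 * Real.log 2 ≤ (3 / 2 * δ) * Real.log (2 * x) ∧
      (1 / 3 + δ / 2) * Real.log (2 * x) < Real.log (x / 64) ∧
      64 * (2 * x) ^ (1 / 3 + δ / 2) ≤ 2 * x ∧
      64 * (2 * x) ^ (2 * δ) ≤ 2 * x := by
  have h2x : Tendsto (fun x : ℝ => 2 * x) atTop atTop := Filter.tendsto_id.const_mul_atTop two_pos
  have hlog2x : Tendsto (fun x : ℝ => Real.log (2 * x)) atTop atTop := Real.tendsto_log_atTop.comp h2x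
  have hlogx : Tendsto (fun x : ℝ => Real.log x) atTop atTop := Real.tendsto_log_atTop
  -- (C1), (C3) through `log x`
  have e1 : ∀ᶠ x : ℝ in atTop, 2 * δ * Real.log (2 * x) ≤ Real.log (x / 64) ∧
      (1 / 3 + δ / 2) * Real.log (2 * x) < Real.log (x / 64) := by
    have hc : 0 < 1 - (1 / 3 + δ / 2) := by linarith
    filter_upwards [hlogx.eventually_ge_atTop ((Real.log 64 + Real.log 2) / (1 - (1 / 3 + δ / 2)) + 1),
      Filter.eventually_ge_atTop (1 : ℝ)] with x hx hx1
    have hx0 : 0 < x := by linarith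
    rw [Real.log_div hx0.ne' (by norm_num), Real.log_mul (by norm_num) hx0.ne']
    have hL0 : 0 ≤ Real.log x := Real.log_nonneg hx1
    have hl2 : 0 < Real.log 2 := Real.log_pos (by norm_num)
    have hl64 : 0 < Real.log 64 := Real.log_pos (by norm_num)
    have hkey : (Real.log 64 + Real.log 2) / (1 - (1 / 3 + δ / 2)) + 1 ≤ Real.log x := hx
    rw [div_add_one hc.ne', div_le_iff₀ hc] at hkey
    constructor <;> nlinarith
  -- (C2) through `log 2x`
  have e2 : ∀ᶠ x : ℝ in atTop, 6 * Real.log 2 ≤ (3 / 2 * δ) * Real.log (2 * x) := by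
    filter_upwards [hlog2x.eventually_ge_atTop (6 * Real.log 2 / (3 / 2 * δ))] with x hx
    rwa [div_le_iff₀' (by positivity)] at hx
  -- (C7), (C10) through powers of `2x`
  have epow : ∀ s : ℝ, 0 < s → s < 1 → ∀ᶠ x : ℝ in atTop, 64 * (2 * x) ^ s ≤ 2 * x := by
    intro s hs hs1
    have ht : Tendsto (fun x : ℝ => (2 * x) ^ (1 - s)) atTop atTop := (tendsto_rpow_atTop (by linarith)).comp h2x
    filter_upwards [ht.eventually_ge_atTop 64, Filter.eventually_ge_atTop (1 : ℝ)] with x hx hx1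
    have h0 : 0 < 2 * x := by linarith
    calc 64 * (2 * x) ^ s ≤ (2 * x) ^ (1 - s) * (2 * x) ^ s := mul_le_mul_of_nonneg_right hx (Real.rpow_nonneg h0.le s)
      _ = 2 * x := by rw [← Real.rpow_add h0]; norm_num
  filter_upwards [Filter.eventually_ge_atTop (1 : ℝ), e1, e2, epow (1 / 3 + δ / 2) (by linarith) (by linarith),
    epow (2 * δ) (by linarith) (by linarith)] with x h1 h2 h3 h4 h5
  exact ⟨h1, h2.1, h3, h2.2, h4, h5⟩

/-- The smallest dyadic scale `Y/(2(log Y)^{13})` tends to infinity. [folklore] -/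
theorem tendsto_lowScale : Tendsto (fun Y : ℝ => Y / (2 * Real.log Y ^ 13)) atTop atTop := by
  -- `(log Y)^{13} ≤ Y^{1/2}` eventually, so the scale is `≥ Y^{1/2}/2`
  have hev : ∀ᶠ Y : ℝ in atTop, Y ^ ((1 : ℝ) / 2) / 2 ≤ Y / (2 * Real.log Y ^ 13) := by
    filter_upwards [eventually_log_rpow_le_rpow' 13 (by norm_num : (0 : ℝ) < 1 / 2),
      Filter.eventually_gt_atTop (1 : ℝ)] with Y hY hY1
    have hL : 0 < Real.log Y := Real.log_pos hY1
    have hY0 : 0 < Y := by linarith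
    have hY' : Real.log Y ^ 13 ≤ Y ^ ((1 : ℝ) / 2) := by
      have e : Real.log Y ^ 13 = Real.log Y ^ ((13 : ℕ) : ℝ) := (Real.rpow_natCast _ 13).symm
      rw [e]; exact_mod_cast hY
    rw [div_le_div_iff₀ (by norm_num) (by positivity)]
    calc Y ^ ((1 : ℝ) / 2) * (2 * Real.log Y ^ 13) = 2 * (Y ^ ((1 : ℝ) / 2) * Real.log Y ^ 13) := by ring
      _ ≤ 2 * (Y ^ ((1 : ℝ) / 2) * Y ^ ((1 : ℝ) / 2)) := by
          have h0 : 0 ≤ Y ^ ((1 : ℝ) / 2) := Real.rpow_nonneg hY0.le _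
          exact mul_le_mul_of_nonneg_left (mul_le_mul_of_nonneg_left hY' h0) (by norm_num)
      _ = Y * 2 := by rw [← Real.rpow_add hY0]; norm_num; ring
  refine Filter.tendsto_atTop_mono' _ hev ?_
  exact (tendsto_rpow_atTop (by norm_num)).atTop_div_const (by norm_num)

/-- The conditions at the height `Y`. [folklore] -/
theorem Y_conditions_eventually (hδ : 0 < δ) (hδρ : 4 * δ ≤ ρ) {A₁ : ℕ} (hA₁ : 1 ≤ A₁) :
    ∀ᶠ Y : ℝ in atTop, 4 ≤ Y ∧ 1 ≤ Real.log Y ∧ 2 ≤ Real.log Y ^ A₁ ∧ 2 ≤ Y ^ δ ∧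
      (3 / 2) * Y ^ δ ≤ (Y / Real.log Y ^ 13) ^ (2 * δ) ∧
      64 * Y ^ (1 / 3 + δ / 2) ≤ Y ^ (1 / 3 + δ) ∧
      64 * Y ^ (2 * δ) ≤ Y ^ ρ ∧
      2 ^ 10 * Y ^ (1 / 2 + 2 * δ) ≤ Y ^ (1 / 2 + ρ) := by
  have hlog : Tendsto (fun Y : ℝ => Real.log Y) atTop atTop := Real.tendsto_log_atTop
  have hpowδ : Tendsto (fun Y : ℝ => Y ^ δ) atTop atTop := tendsto_rpow_atTop hδ
  have hρδ : 0 < ρ - 2 * δ := by linarith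
  -- generic: `c ≤ Y^s` eventually for `s > 0`, hence `c Y^a ≤ Y^{a+s}`
  have hgap : ∀ (c a s : ℝ), 0 < s → ∀ᶠ Y : ℝ in atTop, c * Y ^ a ≤ Y ^ (a + s) := by
    intro c a s hs
    filter_upwards [(tendsto_rpow_atTop hs).eventually_ge_atTop c, Filter.eventually_gt_atTop (0 : ℝ)] with Y hY hY0
    rw [Real.rpow_add hY0, mul_comm]
    exact mul_le_mul_of_nonneg_left hY (Real.rpow_nonneg hY0.le a)
  have e5 : ∀ᶠ Y : ℝ in atTop, (3 / 2) * Y ^ δ ≤ (Y / Real.log Y ^ 13) ^ (2 * δ) := by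
    filter_upwards [eventually_log_rpow_le_rpow' (26 * δ) (by positivity : (0 : ℝ) < δ / 2),
      (tendsto_rpow_atTop (by positivity : (0 : ℝ) < δ / 2)).eventually_ge_atTop (3 / 2),
      Filter.eventually_gt_atTop (1 : ℝ)] with Y h1 h2 hY1
    have hY0 : 0 < Y := by linarith
    have hL : 0 < Real.log Y := Real.log_pos hY1
    rw [Real.div_rpow hY0.le (by positivity), ← Real.rpow_natCast, ← Real.rpow_mul hL.le]
    rw [le_div_iff₀ (by positivity)]
    have e : ((13 : ℕ) : ℝ) * (2 * δ) = 26 * δ := by push_cast; ring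
    rw [e]
    calc 3 / 2 * Y ^ δ * Real.log Y ^ (26 * δ) ≤ Y ^ (δ / 2) * Y ^ δ * Y ^ (δ / 2) := by
          gcongr
      _ = Y ^ (2 * δ) := by rw [← Real.rpow_add hY0, ← Real.rpow_add hY0]; ring_nf
  filter_upwards [Filter.eventually_ge_atTop (4 : ℝ), hlog.eventually_ge_atTop 1,
    (Filter.Tendsto.comp (tendsto_pow_atTop (by omega : A₁ ≠ 0) |>.comp hlog) tendsto_id |>.eventually_ge_atTop 2),
    hpowδ.eventually_ge_atTop 2, e5, hgap 64 (1 / 3 + δ / 2) (δ / 2) (by positivity),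
    hgap 64 (2 * δ) (ρ - 2 * δ) hρδ, hgap (2 ^ 10) (1 / 2 + 2 * δ) (ρ - 2 * δ) hρδ] with Y h1 h2 h3 h4 h5 h6 h7 h8
  refine ⟨h1, h2, ?_, h4, h5, ?_, ?_, ?_⟩
  · simpa using h3
  · convert h6 using 2; ring
  · convert h7 using 2; ring
  · convert h8 using 2; ring

/-- **`ScaleOK` for large heights**: with `0 < δ ≤ 1/12`, `4δ ≤ ρ`, `A₁ ≥ 1`, for all large `Y`,
every level `Q ≤ Y^{δ/4}`, every scale `x ∈ [Y/(2(log Y)^{13}), Y/2]` and every `j ∈ {1,2,3}`: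
`ScaleOK j x Y (Δf A₁ Y) δ ρ (2δ) (1/3 + δ/2) (Ucut x) Q`. [folklore] -/
theorem scaleOK_eventually (hδ : 0 < δ) (hδ12 : δ ≤ 1 / 12) (hδρ : 4 * δ ≤ ρ) {A₁ : ℕ} (hA₁ : 1 ≤ A₁) :
    ∀ᶠ Y : ℝ in atTop, ∀ Q : ℕ, (Q : ℝ) ≤ Y ^ (δ / 4) → ∀ x : ℝ, Y / (2 * Real.log Y ^ 13) ≤ x → 2 * x ≤ Y →
      ∀ j ∈ Icc 1 3, ScaleOK j x Y (Δf A₁ Y) δ ρ (2 * δ) (1 / 3 + δ / 2) (Ucut x) Q := by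
  obtain ⟨x₀, hx₀⟩ := Filter.eventually_atTop.1 (x_conditions_eventually hδ hδ12)
  filter_upwards [Y_conditions_eventually hδ hδρ hA₁, tendsto_lowScale.eventually_ge_atTop x₀] with Y hY hlo Q hQ x hx hxY j hj
  obtain ⟨hY4, hL1, hLA, h2, hC5, hC6, hC9, hC11⟩ := hY
  obtain ⟨hx1, xC1, xC2, xC3, xC7, xC10⟩ := hx₀ x (hlo.trans hx)
  obtain ⟨hj1, hj3⟩ := Finset.mem_Icc.1 hj
  have hY1 : 1 ≤ Y := by linarith
  have hY0 : 0 < Y := by linarith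
  have hx0 : 0 < x := by linarith
  have h2x0 : 0 < 2 * x := by linarith
  have hL0 : 0 < Real.log Y := by linarith
  obtain ⟨hΔ0, hΔhalf⟩ := Δf_bounds hLA
  -- `2^{2j} ≤ 64`, `2^{3j+1} ≤ 2^{10}`
  have hpow64 : (2 : ℝ) ^ (2 * j) ≤ 64 := by
    calc (2 : ℝ) ^ (2 * j) ≤ 2 ^ 6 := pow_le_pow_right₀ (by norm_num) (by omega)
      _ = 64 := by norm_num
  have hpow10 : (2 : ℝ) ^ (3 * j + 1) ≤ 2 ^ 10 := pow_le_pow_right₀ (by norm_num) (by omega)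
  -- `log (x/64) ≤ log (x/2^{2j})`
  have hlog64 : Real.log (x / 64) ≤ Real.log (x / 2 ^ (2 * j)) := by
    refine Real.log_le_log (by positivity) (div_le_div_of_nonneg_left hx0.le (by positivity) hpow64)
  -- powers of `2x` against powers of `Y`
  have hrp : ∀ s : ℝ, 0 ≤ s → (2 * x) ^ s ≤ Y ^ s := fun s hs => Real.rpow_le_rpow h2x0.le hxY hs
  refine ⟨hx1, hxY, hΔ0, hΔhalf, ?_, ?_, h2, by linarith, by linarith, by linarith, ?_, ?_, ?_, ?_, ?_, ?_, ?_, ?_, ?_, ?_⟩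
  · -- `Q ≤ ⌊Y^{δ/2}⌋`
    refine Nat.le_floor (hQ.trans (Real.rpow_le_rpow_of_exponent_le hY1 (by linarith)))
  · -- `Q ≤ ⌊Y^ρ⌋`
    refine Nat.le_floor (hQ.trans (Real.rpow_le_rpow_of_exponent_le hY1 (by linarith)))
  · -- (C1)
    exact xC1.trans hlog64
  · -- (C2): `2j log 2 ≤ 6 log 2 ≤ (3/2)δ log 2x`
    have hl2 : 0 < Real.log 2 := Real.log_pos (by norm_num)
    have hj' : (2 : ℝ) * j * Real.log 2 ≤ 6 * Real.log 2 := by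
      have : (j : ℝ) ≤ 3 := by exact_mod_cast hj3
      nlinarith
    have : 3 * (1 / 3 + δ / 2) * Real.log (2 * x) = Real.log (2 * x) + (3 / 2 * δ) * Real.log (2 * x) := by ring
    rw [this]; linarith
  · -- (C3)
    exact lt_of_lt_of_le xC3 hlog64
  · -- (C5): `(1+Δ) Y^δ ≤ (3/2) Y^δ ≤ (Y/(log Y)^11)^{2δ} ≤ (2x)^{2δ}`
    have h1 : (1 + Δf A₁ Y) * Y ^ δ ≤ 3 / 2 * Y ^ δ :=
      mul_le_mul_of_nonneg_right (by linarith) (Real.rpow_nonneg hY0.le δ)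
    refine h1.trans (hC5.trans ?_)
    refine Real.rpow_le_rpow (by positivity) ?_ (by linarith)
    -- `Y/(log Y)^13 = 2 · (Y/(2 (log Y)^13)) ≤ 2x`
    have : Y / Real.log Y ^ 13 = 2 * (Y / (2 * Real.log Y ^ 13)) := by field_simp
    rw [this]; linarith
  · -- (C6)
    calc (2 : ℝ) ^ (2 * j) * (2 * x) ^ (1 / 3 + δ / 2) ≤ 64 * Y ^ (1 / 3 + δ / 2) :=
          mul_le_mul hpow64 (hrp _ (by linarith)) (Real.rpow_nonneg h2x0.le _) (by norm_num)
      _ ≤ Y ^ (1 / 3 + δ) := hC6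
  · -- (C7)
    calc (2 : ℝ) ^ (2 * j) * (2 * x) ^ (1 / 3 + δ / 2) ≤ 64 * (2 * x) ^ (1 / 3 + δ / 2) :=
          mul_le_mul_of_nonneg_right hpow64 (Real.rpow_nonneg h2x0.le _)
      _ ≤ 2 * x := xC7
  · -- (C9)
    calc (2 : ℝ) ^ (2 * j) * (2 * x) ^ (2 * δ) ≤ 64 * Y ^ (2 * δ) :=
          mul_le_mul hpow64 (hrp _ (by linarith)) (Real.rpow_nonneg h2x0.le _) (by norm_num)
      _ ≤ Y ^ ρ := hC9
  · -- (C10)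
    calc (2 : ℝ) ^ (2 * j) * (2 * x) ^ (2 * δ) ≤ 64 * (2 * x) ^ (2 * δ) :=
          mul_le_mul_of_nonneg_right hpow64 (Real.rpow_nonneg h2x0.le _)
      _ ≤ 2 * x := xC10
  · -- (C11)
    calc (2 : ℝ) ^ (3 * j + 1) * (2 * x) ^ (1 / 2 + 2 * δ) ≤ 2 ^ 10 * Y ^ (1 / 2 + 2 * δ) :=
          mul_le_mul hpow10 (hrp _ (by linarith)) (Real.rpow_nonneg h2x0.le _) (by norm_num)
      _ ≤ Y ^ (1 / 2 + ρ) := hC11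
  · -- `U ≤ (2x)^{b'}`
    exact Ucut_le (by linarith) (by linarith)

end Eventually

end Summit.Parity.GeneralizedHardyLittlewood.Theorems.SieveToMAvg
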